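import Literature.NumberTheory.Sieve.RosserSieveRecurrences
import Literature.NumberTheory.Sieve.RosserSieveMajorants
import HarnessLib

/-!
# Iwaniec's Lemma 17: the majorisation `T^±_R < c q^±`, proved from Lemma 13

Topic `Literature/NumberTheory/Sieve`; fifth file on Iwaniec, *Rosser's sieve*, Acta Arith. 36 (1980).
Lemma 17 (p. 194): "There exists a constant `c > 0` such that (7.6) `T^±_R(s) < c q^±(s)` for
`s > β − (1±1)/2`" — the uniform (in `R`) majorisation of the partial sums `T^±_R` of §7 by the
functions `q^± = s^{κ+1} Q^±` of §6, which gives the convergence of the series (Lemma 18) and enters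
the error term `G^±_z(s)` of Lemma 20. Here it is PROVED for `κ > 1/2` and the greatest `β`-sieve
data (`β = β_κ`), with `T^±_R = BetaSieve.contT` (`RosserSieveSums.lean`) and
`q^± = RosserMajorant.qUpper/qLower κ β` (`RosserSieveMajorants.lean`), from the two inputs of
Lemma 13 that the printed proof uses — positivity of `q^±` and `β > 1` — supplied by the named fact
`RosserMajorant.Iwaniec1980_lemma13`; the recurrences (7.3) (`RosserSieveRecurrences.lean`) and the
integrated equations (6.2) (`qUpper/qLower_sub_eq_integral`) replace the printed appeal to (7.4).

* `BetaSieve.sieveKernel_eq_mul`, `sieveKernel_mul_le`, `sieveKernel_mul_le_of_le` — the kernel of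
  (7.3) is `((t − 1)/t)` times that of (7.4);
* `BetaSieve.contT_zero_succ_le`, `contT_one_succ_le` — Iwaniec's induction steps in finite form
  (`T⁻_{N+1}(s) ≤ c (q⁻(s) − q⁻(U))`, `T⁺_{N+1}(s) ≤ c (q⁺(s) − q⁺(U))`);
* `BetaSieve.contT_one_succ_le_refined`, `qUpper_sub_pos` — "for `s = β + 1` we must save a little";
* `BetaSieve.exists_const_contT_lt_of_pos` — Lemma 17 for any `κ > 0`, `β > 1` and any positive
  forward solution `q^±` (no named fact); `BetaSieve.Iwaniec1980_lemma17_of_lemma13` — Lemma 17 for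
  the greatest data, `κ > 1/2` (on the closed ranges `s ≥ β`, `s ≥ β − 1`).

## References

* H. Iwaniec, *Rosser's sieve*, Acta Arith. 36 (1980), 171–202, §7, Lemma 17 and its proof
  (pp. 194–195), (7.3)–(7.6). [IwaniecActaArith1980]
-/

open Filter Set MeasureTheory intervalIntegral
open scoped Topology

noncomputable section

namespace Literature.NumberTheory.Sieve

open BetaSieveForward (sieveKernel sieveKernel_nonneg continuousOn_sieveKernel)

namespace BetaSieve

open RosserMajorant

variable {κ β : ℝ}

/-- Pointwise comparison of the kernels of (7.3) and (7.4):
`κ t^{κ−1} (t − 1)^{−κ} = ((t − 1)/t) · κ t^κ (t − 1)^{−κ−1} ≤ κ t^κ (t − 1)^{−κ−1}` for `t > 1`,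
`κ ≥ 0`. [folklore] -/
theorem sieveKernel_eq_mul (κ : ℝ) {t : ℝ} (ht : 1 < t) :
    sieveKernel κ t = (t - 1) / t * (κ * t ^ κ * (t - 1) ^ (-κ - 1)) := by
  have ht0 : 0 < t := by linarith
  have ht1 : 0 < t - 1 := by linarith
  have e : (t - 1) ^ (-κ) = (t - 1) ^ (-κ - 1) * (t - 1) := by
    rw [← Real.rpow_add_one ht1.ne']; congr 1; ring
  rw [sieveKernel, Real.rpow_sub_one ht0.ne', e]
  field_simp

/-- `k(t) φ ≤ κ t^κ (t − 1)^{−κ−1} φ` for `t > 1`, `κ ≥ 0`, `φ ≥ 0`. [folklore] -/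
theorem sieveKernel_mul_le {κ : ℝ} (hκ : 0 ≤ κ) {t φ : ℝ} (ht : 1 < t) (hφ : 0 ≤ φ) :
    sieveKernel κ t * φ ≤ κ * t ^ κ * (t - 1) ^ (-κ - 1) * φ := by
  rw [sieveKernel_eq_mul κ ht]
  have h1 : (t - 1) / t ≤ 1 := by rw [div_le_one (by linarith)]; linarith
  have h2 : 0 ≤ κ * t ^ κ * (t - 1) ^ (-κ - 1) := by
    have := Real.rpow_nonneg (by linarith : (0:ℝ) ≤ t) κ
    have := Real.rpow_nonneg (by linarith : (0:ℝ) ≤ t - 1) (-κ - 1)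
    positivity
  nlinarith [mul_nonneg h2 hφ]

/-- The refined comparison on `t ≤ T`: `k(t) φ ≤ ((T − 1)/T) κ t^κ (t − 1)^{−κ−1} φ` for `1 < t ≤ T`.
[folklore] -/
theorem sieveKernel_mul_le_of_le {κ : ℝ} (hκ : 0 ≤ κ) {t T φ : ℝ} (ht : 1 < t) (htT : t ≤ T)
    (hφ : 0 ≤ φ) :
    sieveKernel κ t * φ ≤ (T - 1) / T * (κ * t ^ κ * (t - 1) ^ (-κ - 1) * φ) := by
  rw [sieveKernel_eq_mul κ ht]
  have hT : 0 < T := by linarith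
  have h1 : (t - 1) / t ≤ (T - 1) / T := by
    rw [div_le_div_iff₀ (by linarith) hT]; nlinarith
  have h2 : 0 ≤ κ * t ^ κ * (t - 1) ^ (-κ - 1) * φ := by
    have := Real.rpow_nonneg (by linarith : (0:ℝ) ≤ t) κ
    have := Real.rpow_nonneg (by linarith : (0:ℝ) ≤ t - 1) (-κ - 1)
    positivity
  calc (t - 1) / t * (κ * t ^ κ * (t - 1) ^ (-κ - 1)) * φ
      = (t - 1) / t * (κ * t ^ κ * (t - 1) ^ (-κ - 1) * φ) := by ring
    _ ≤ (T - 1) / T * (κ * t ^ κ * (t - 1) ^ (-κ - 1) * φ) := mul_le_mul_of_nonneg_right h1 h2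

/-! ### The two induction steps of Lemma 17 -/

section Steps

variable (hκ : 0 ≤ κ) (hβ : 1 < β)
include hκ hβ

/-- **The `−` step** (Iwaniec, proof of Lemma 17: "from (7.3) and the inductive assumption (7.6) we
obtain `T⁻_R(s) < cκ ∫_s^∞ (1 − 1/t)^{−κ} q⁺(t − 1) dt/t < c q⁻(s)` for `s ≥ β`"), in finite form: if
`T⁺_N ≤ c q⁺` on `[β − 1, ∞)` and `q⁺ ≥ 0` there, then for `s ≥ β` and `U = max(s, β + N + 1)`,
`T⁻_{N+1}(s) ≤ c (q⁻(s) − q⁻(U))`. [cite: IwaniecActaArith1980, Lemma 17 (proof)] -/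
theorem contT_zero_succ_le {c : ℝ} (hc : 0 ≤ c) {N : ℕ}
    (hq : ∀ u, β - 1 ≤ u → 0 ≤ qUpper κ β u)
    (hP : ∀ u, β - 1 ≤ u → contT 1 κ β N u ≤ c * qUpper κ β u) {s : ℝ} (hs : β ≤ s) :
    contT 0 κ β (N + 1) s ≤
      c * (qLower κ β s - qLower κ β (max s (β + N + 1))) := by
  set U := max s (β + N + 1) with hU
  have hs1 : 1 < s := by linarith
  have hsU : s ≤ U := le_max_left _ _
  rw [contT_zero_succ_eq_integral hκ hβ N hs le_rfl, qLower_sub_eq_integral hβ hs hsU,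
    ← intervalIntegral.integral_const_mul]
  refine intervalIntegral.integral_mono_on hsU
    (intervalIntegrable_sieveKernel_mul (continuous_contT hκ hβ 1 N) hs1 hsU) ?_ fun t ht => ?_
  · have hcont : ContinuousOn (fun t => c * (κ * t ^ κ * (t - 1) ^ (-κ - 1) * qUpper κ β (t - 1)))
        (uIcc s U) := by
      rw [uIcc_of_le hsU]
      exact continuousOn_const.mul ((continuousOn_integrand_qUpper (κ := κ) hβ).mono
        fun t ht => show (1 : ℝ) < t from lt_of_lt_of_le hs1 ht.1)
    exact hcont.intervalIntegrable
  · have ht1 : 1 < t := lt_of_lt_of_le hs1 ht.1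
    have hu : β - 1 ≤ t - 1 := by have := ht.1; linarith
    calc sieveKernel κ t * contT 1 κ β N (t - 1)
        ≤ sieveKernel κ t * (c * qUpper κ β (t - 1)) :=
          mul_le_mul_of_nonneg_left (hP _ hu) (sieveKernel_nonneg hκ ht1.le)
      _ ≤ κ * t ^ κ * (t - 1) ^ (-κ - 1) * (c * qUpper κ β (t - 1)) :=
          sieveKernel_mul_le hκ ht1 (mul_nonneg hc (hq _ hu))
      _ = c * (κ * t ^ κ * (t - 1) ^ (-κ - 1) * qUpper κ β (t - 1)) := by ring

end Steps

section Steps2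

variable (hκ : 0 ≤ κ) (hβ : 1 < β)
include hκ hβ

/-- **The `+` step for `s ≥ β + 1`** (Iwaniec, proof of Lemma 17: "the same argument applies to
`T⁺_R(s)`, `s ≥ β + 1`"), in finite form: if `T⁻_N ≤ c q⁻` on `[β, ∞)` and `q⁻ ≥ 0` there, then for
`s ≥ β + 1` and `U = max(s, β + N + 1)`, `T⁺_{N+1}(s) ≤ c (q⁺(s) − q⁺(U))`.
[cite: IwaniecActaArith1980, Lemma 17 (proof)] -/
theorem contT_one_succ_le {c : ℝ} (hc : 0 ≤ c) {N : ℕ}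
    (hq : ∀ u, β ≤ u → 0 ≤ qLower κ β u)
    (hM : ∀ u, β ≤ u → contT 0 κ β N u ≤ c * qLower κ β u) {s : ℝ} (hs : β + 1 ≤ s) :
    contT 1 κ β (N + 1) s ≤
      c * (qUpper κ β s - qUpper κ β (max s (β + N + 1))) := by
  set U := max s (β + N + 1) with hU
  have hs1 : 1 < s := by linarith
  have hsU : s ≤ U := le_max_left _ _
  rw [contT_one_succ_eq_integral hκ hβ N hs le_rfl, qUpper_sub_eq_integral hβ hs hsU,
    ← intervalIntegral.integral_const_mul]
  refine intervalIntegral.integral_mono_on hsU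
    (intervalIntegrable_sieveKernel_mul (continuous_contT hκ hβ 0 N) hs1 hsU) ?_ fun t ht => ?_
  · have hcont : ContinuousOn (fun t => c * (κ * t ^ κ * (t - 1) ^ (-κ - 1) * qLower κ β (t - 1)))
        (uIcc s U) := by
      rw [uIcc_of_le hsU]
      exact continuousOn_const.mul ((continuousOn_integrand_qLower (κ := κ) hβ).mono
        fun t ht => show (1 : ℝ) < t from lt_of_lt_of_le hs1 ht.1)
    exact hcont.intervalIntegrable
  · have ht1 : 1 < t := lt_of_lt_of_le hs1 ht.1
    have hu : β ≤ t - 1 := by have := ht.1; linarith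
    calc sieveKernel κ t * contT 0 κ β N (t - 1)
        ≤ sieveKernel κ t * (c * qLower κ β (t - 1)) :=
          mul_le_mul_of_nonneg_left (hM _ hu) (sieveKernel_nonneg hκ ht1.le)
      _ ≤ κ * t ^ κ * (t - 1) ^ (-κ - 1) * (c * qLower κ β (t - 1)) :=
          sieveKernel_mul_le hκ ht1 (mul_nonneg hc (hq _ hu))
      _ = c * (κ * t ^ κ * (t - 1) ^ (-κ - 1) * qLower κ β (t - 1)) := by ring

/-- **The `+` step at `s = β + 1`, "saving a little"** (Iwaniec, proof of Lemma 17: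
`T⁺_R(β + 1) < c(1 − δ) q⁺(β + 1)`): on `[β + 1, β + 2]` the kernel comparison improves by the factor
`θ = (β + 1)/(β + 2)`, so with `U = max(β + 2, β + N + 1)`,
`T⁺_{N+1}(β + 1) ≤ c (q⁺(β + 1) − q⁺(U)) − c (1 − θ)(q⁺(β + 1) − q⁺(β + 2))`.
[cite: IwaniecActaArith1980, Lemma 17 (proof)] -/
theorem contT_one_succ_le_refined {c : ℝ} (hc : 0 ≤ c) {N : ℕ}
    (hq : ∀ u, β ≤ u → 0 ≤ qLower κ β u)
    (hM : ∀ u, β ≤ u → contT 0 κ β N u ≤ c * qLower κ β u) :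
    contT 1 κ β (N + 1) (β + 1) ≤
      c * (qUpper κ β (β + 1) - qUpper κ β (max (β + 2) (β + N + 1))) -
        c * (1 - (β + 1) / (β + 2)) * (qUpper κ β (β + 1) - qUpper κ β (β + 2)) := by
  set U := max (β + 2) (β + N + 1) with hU
  set g : ℝ → ℝ := fun t => κ * t ^ κ * (t - 1) ^ (-κ - 1) * qLower κ β (t - 1) with hg
  have hb1 : (1 : ℝ) < β + 1 := by linarith
  have hb12 : β + 1 ≤ β + 2 := by linarith
  have h2U : β + 2 ≤ U := le_max_left _ _
  have h1U : β + 1 ≤ U := hb12.trans h2U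
  have hUge : max (β + 1) (β + N + 1) ≤ U := max_le h1U (le_max_right _ _)
  rw [contT_one_succ_eq_integral hκ hβ N le_rfl hUge]
  -- split the integral at `β + 2`
  have hi1 := intervalIntegrable_sieveKernel_mul (κ := κ) (continuous_contT hκ hβ 0 N) hb1 hb12
  have hi2 := intervalIntegrable_sieveKernel_mul (κ := κ) (continuous_contT hκ hβ 0 N)
    (by linarith : (1 : ℝ) < β + 2) h2U
  rw [← intervalIntegral.integral_add_adjacent_intervals hi1 hi2]
  -- continuity of `g` on `[β + 1, U]`
  have hgcont : ∀ a b, β + 1 ≤ a → a ≤ b → ContinuousOn g (uIcc a b) := by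
    intro a b ha hab
    rw [uIcc_of_le hab]
    exact (continuousOn_integrand_qLower (κ := κ) hβ).mono
      fun t ht => show (1 : ℝ) < t from by linarith [ht.1]
  have hpt : ∀ t, β + 1 ≤ t →
      sieveKernel κ t * contT 0 κ β N (t - 1) ≤ sieveKernel κ t * (c * qLower κ β (t - 1)) :=
    fun t ht => mul_le_mul_of_nonneg_left (hM _ (by linarith)) (sieveKernel_nonneg hκ (by linarith))
  -- first piece, with the factor `θ`
  have hθ0 : 0 ≤ (β + 1) / (β + 2) := by positivity
  have h1 : ∫ t in (β + 1)..(β + 2), sieveKernel κ t * contT 0 κ β N (t - 1) ≤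
      ∫ t in (β + 1)..(β + 2), (β + 1) / (β + 2) * c * g t := by
    refine intervalIntegral.integral_mono_on hb12 hi1
      (((hgcont _ _ le_rfl hb12).intervalIntegrable.const_mul ((β + 1) / (β + 2) * c)).congr
        fun t _ => by simp only [hg])
      fun t ht => (hpt t ht.1).trans ?_
    have ht1 : 1 < t := by linarith [ht.1]
    have := sieveKernel_mul_le_of_le hκ ht1 ht.2 (mul_nonneg hc (hq (t - 1) (by linarith [ht.1])))
    calc sieveKernel κ t * (c * qLower κ β (t - 1))
        ≤ (β + 2 - 1) / (β + 2) * (κ * t ^ κ * (t - 1) ^ (-κ - 1) * (c * qLower κ β (t - 1))) := this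
      _ = (β + 1) / (β + 2) * c * g t := by simp only [hg]; ring
  -- second piece
  have h2 : ∫ t in (β + 2)..U, sieveKernel κ t * contT 0 κ β N (t - 1) ≤
      ∫ t in (β + 2)..U, c * g t := by
    refine intervalIntegral.integral_mono_on h2U hi2
      (((hgcont _ _ hb12 h2U).intervalIntegrable.const_mul c).congr fun t _ => by simp only [hg])
      fun t ht => (hpt t (by linarith [ht.1])).trans ?_
    have ht1 : 1 < t := by linarith [ht.1]
    have := sieveKernel_mul_le hκ ht1 (mul_nonneg hc (hq (t - 1) (by linarith [ht.1])))
    calc sieveKernel κ t * (c * qLower κ β (t - 1))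
        ≤ κ * t ^ κ * (t - 1) ^ (-κ - 1) * (c * qLower κ β (t - 1)) := this
      _ = c * g t := by simp only [hg]; ring
  -- evaluate the integrals of `g`
  have hg1 : ∫ t in (β + 1)..(β + 2), g t = qUpper κ β (β + 1) - qUpper κ β (β + 2) :=
    (qUpper_sub_eq_integral hβ le_rfl hb12).symm
  have hg2 : ∫ t in (β + 2)..U, g t = qUpper κ β (β + 2) - qUpper κ β U :=
    (qUpper_sub_eq_integral hβ hb12 h2U).symm
  rw [intervalIntegral.integral_const_mul, hg1] at h1
  rw [intervalIntegral.integral_const_mul, hg2] at h2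
  have : (β + 1) / (β + 2) * c * (qUpper κ β (β + 1) - qUpper κ β (β + 2)) +
      c * (qUpper κ β (β + 2) - qUpper κ β U) =
      c * (qUpper κ β (β + 1) - qUpper κ β U) -
        c * (1 - (β + 1) / (β + 2)) * (qUpper κ β (β + 1) - qUpper κ β (β + 2)) := by ring
  linarith

end Steps2

/-! ### Lemma 17 from Lemma 13 -/

/-- `q⁺(β + 1) > q⁺(β + 2)`: `q⁺` strictly decreases on `[β + 1, β + 2]` (positive integrand), granted
the positivity of `q⁻` (Lemma 13). [folklore] -/
theorem qUpper_sub_pos (hκ : 0 < κ) (hβ : 1 < β) (hpos : ∀ u, 0 < u → 0 < qLower κ β u) :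
    0 < qUpper κ β (β + 1) - qUpper κ β (β + 2) := by
  have hb12 : β + 1 ≤ β + 2 := by linarith
  rw [qUpper_sub_eq_integral hβ le_rfl hb12]
  have hcont : ContinuousOn (fun t => κ * t ^ κ * (t - 1) ^ (-κ - 1) * qLower κ β (t - 1))
      (uIcc (β + 1) (β + 2)) := by
    rw [uIcc_of_le hb12]
    exact (continuousOn_integrand_qLower (κ := κ) hβ).mono fun t ht =>
      show (1 : ℝ) < t from by linarith [ht.1]
  refine intervalIntegral.intervalIntegral_pos_of_pos_on hcont.intervalIntegrable (fun t ht => ?_)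
    (by linarith)
  have ht0 : 0 < t := by linarith [ht.1]
  have ht1 : 0 < t - 1 := by linarith [ht.1]
  have h1 : 0 < t ^ κ := Real.rpow_pos_of_pos ht0 κ
  have h2 : 0 < (t - 1) ^ (-κ - 1) := Real.rpow_pos_of_pos ht1 _
  have h3 := hpos (t - 1) ht1
  positivity

/-- **Lemma 17 with explicit hypotheses**: for `κ > 0`, `β > 1` and ANY forward solution
`(q⁺, q⁻) = (qUpper κ β, qLower κ β)` of (6.1)–(6.2) that is positive on `(0, ∞)`, there is `c > 0`
with `T⁻_N(s) < c q⁻(s)` (`s ≥ β`) and `T⁺_N(s) < c q⁺(s)` (`s ≥ β − 1`) for all `N` — Iwaniec's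
induction (proof of Lemma 17, pp. 194–195) uses nothing else about `q^±`.
[cite: IwaniecActaArith1980, Lemma 17 (proof)] -/
theorem exists_const_contT_lt_of_pos (hκ0 : 0 < κ) (hβ : 1 < β)
    (hpos : ∀ u : ℝ, 0 < u → 0 < qUpper κ β u ∧ 0 < qLower κ β u) :
    ∃ c : ℝ, 0 < c ∧ ∀ N : ℕ,
      (∀ s : ℝ, β ≤ s → contT 0 κ β N s < c * qLower κ β s) ∧
      (∀ s : ℝ, β - 1 ≤ s → contT 1 κ β N s < c * qUpper κ β s) := by
  set η : ℝ := (1 - (β + 1) / (β + 2)) * (qUpper κ β (β + 1) - qUpper κ β (β + 2)) with hη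
  have hθ1 : 0 < 1 - (β + 1) / (β + 2) := by
    rw [sub_pos, div_lt_one (by linarith)]; linarith
  have hη0 : 0 < η := mul_pos hθ1 (qUpper_sub_pos hκ0 hβ fun u hu => (hpos u hu).2)
  set c : ℝ := (β + 1) ^ κ / η + 1 with hc
  have hb1κ : 0 < (β + 1) ^ κ := Real.rpow_pos_of_pos (by linarith) κ
  have hc0 : 0 < c := by rw [hc]; positivity
  have hcη : (β + 1) ^ κ < c * η := by
    rw [hc, add_mul, div_mul_cancel₀ _ hη0.ne', one_mul]; linarith
  refine ⟨c, hc0, fun N => ?_⟩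
  induction N with
  | zero =>
    refine ⟨fun s hs => ?_, fun s hs => ?_⟩
    · rw [contT_zero_right]; exact mul_pos hc0 (hpos s (by linarith)).2
    · rw [contT_zero_right]; exact mul_pos hc0 (hpos s (by linarith)).1
  | succ N ih =>
    obtain ⟨ihM, ihP⟩ := ih
    have hM' : ∀ u, β ≤ u → contT 0 κ β N u ≤ c * qLower κ β u := fun u hu => (ihM u hu).le
    have hP' : ∀ u, β - 1 ≤ u → contT 1 κ β N u ≤ c * qUpper κ β u := fun u hu => (ihP u hu).le
    have hqU : ∀ u, β - 1 ≤ u → 0 ≤ qUpper κ β u := fun u hu => (hpos u (by linarith)).1.le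
    have hqL : ∀ u, β ≤ u → 0 ≤ qLower κ β u := fun u hu => (hpos u (by linarith)).2.le
    refine ⟨fun s hs => ?_, fun s hs => ?_⟩
    · have h := contT_zero_succ_le hκ0.le hβ hc0.le hqU hP' hs
      have hU := (hpos (max s (β + N + 1)) (lt_of_lt_of_le (by linarith) (le_max_left _ _))).2
      nlinarith
    · rcases le_or_gt s (β + 1) with hle | hlt
      · -- `β - 1 ≤ s ≤ β + 1`: (7.3), third line, and the saving at `β + 1`
        have hs0 : 0 < s := by linarith
        have href := contT_one_succ_le_refined hκ0.le hβ hc0.le hqL hM'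
        have hU := (hpos (max (β + 2) (β + N + 1))
          (lt_of_lt_of_le (by linarith) (le_max_left _ _))).1
        have hqs : qUpper κ β s = qUpper κ β (β + 1) := by rw [qUpper_eq hle, qUpper_eq le_rfl]
        have hceq : c * (1 - (β + 1) / (β + 2)) * (qUpper κ β (β + 1) - qUpper κ β (β + 2)) =
            c * η := by rw [hη]; ring
        have hsκ : 0 < s ^ κ := Real.rpow_pos_of_pos hs0 κ
        have hcU := mul_pos hc0 hU
        rw [contT_one_eq_of_le (by omega) hle, hqs]
        linarith
      · have h := contT_one_succ_le hκ0.le hβ hc0.le hqL hM' hlt.le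
        have hU := (hpos (max s (β + N + 1)) (lt_of_lt_of_le (by linarith) (le_max_left _ _))).1
        nlinarith

/-- **Iwaniec's Lemma 17 from Lemma 13** (*Rosser's sieve*, Acta Arith. 36 (1980), Lemma 17:
"There exists a constant `c > 0` such that (7.6) `T^±_R(s) < c q^±(s)` for `s > β − (1±1)/2`").
Here for `κ > 1/2` and the greatest `β`-sieve data `B` (so `β = β_κ > 1`), with `T^±_R` the partial
sums `BetaSieve.contT` and `q^± = RosserMajorant.qUpper/qLower κ β`, PROVED from the positivity of
`q^±` and `β > 1` supplied by `RosserMajorant.Iwaniec1980_lemma13` (`exists_const_contT_lt_of_pos`).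
The ranges are the closed ones `s ≥ β`, `s ≥ β − 1` (which contain the printed open ranges).
[cite: IwaniecActaArith1980, Lemma 17] -/
theorem Iwaniec1980_lemma17_of_lemma13 (h13 : RosserMajorant.Iwaniec1980_lemma13) {κ : ℝ}
    (hκ : 1 / 2 < κ) {B : (ℝ → ℝ) × (ℝ → ℝ) × ℝ × ℝ} (hB : IsGreatestBetaSieveData κ B) :
    ∃ c : ℝ, 0 < c ∧ ∀ N : ℕ,
      (∀ s : ℝ, B.2.2.1 ≤ s → contT 0 κ B.2.2.1 N s < c * qLower κ B.2.2.1 s) ∧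
      (∀ s : ℝ, B.2.2.1 - 1 ≤ s → contT 1 κ B.2.2.1 N s < c * qUpper κ B.2.2.1 s) := by
  obtain ⟨hβ, hpos, -⟩ := h13 hκ B hB
  exact exists_const_contT_lt_of_pos (by linarith) hβ hpos

end BetaSieve

end Literature.NumberTheory.Sieve
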